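import Summits.CriticalPhenomena.PercolationContinuityZ3.Theorems.PercNearOneGluingNoHeavyLowerTailSahiMixtureIrredundant
import Summits.CriticalPhenomena.PercolationContinuityZ3.Theorems.PercNearOneGluingNoHeavyLowerTailSahiCombDisjunctAllOrders
import Summits.CriticalPhenomena.PercolationContinuityZ3.Theorems.PercNearOneGluingNoHeavyLowerTailSahiCombMeetAbsorbing

/-!
# The comb (tensor-Bernstein) hierarchy for Sahi's `E_k`, XXXIII: the HEREDITARY COMB CLASS — uncovered / irredundant reduction at the
# comb level; over three increasing events the single cubic row carries the whole intersection-closed family; comb H-MIX(3);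
# hitting families of three coordinate sets are comb-positive at every order

Support file of the one-cut programme (crux `NoHeavyLowerTail`, stmt-CriticalPhenomena-4575; cell `prim-masterthm`, seat P3, gen 8;
`run/shared/lean/prim/prim-masterthm/prim-masterthm-p3/HIERARCHY.md` §15).  Vocabulary: `SahiComb.CombPos` (`…SahiCombPositivity`), the law-level
hereditary class `SahiMixture.HereditaryAllOrders` and its UNCOVERED / IRREDUNDANT reductions (`…SahiMixtureIrredundant`), the comb-level total-meet rung
`combPos_sahiE_ind_of_totalMeet_local` (`…SahiCombMeetAbsorbing`), the order-3 disjunctive closure `SahiCombDisjunct.combPos_sahiE_three_unionCoord` and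
`SahiCombDisjunct.orCoord` / `CombAllOrders` (`…SahiCombDisjunctAllOrders`).

WHY (HIERARCHY §12(k), §13, §14).  At the LAW level the right invariant for OR-mixing is the HEREDITARY class `𝒦` (the ∩-closed family generated by the events
is Sahi-nonnegative at every order): H-MIX(4) is a theorem (`SahiMixture.hereditaryMixture_four`), H-MIX(6) is false (`SahiMixture.not_hereditaryMixturePositivity`)
— the law-level route to OR(∞) is dead, and the product structure must be used: the COMB level.  This file sets up the comb-level mirror.
* `CombHereditary A` — the ∩-closed family `(⋂_{i∈K} A_i)_K` of events of a finite cube is comb-positive at EVERY order (every slot map `K : Fin m → Finset (Fin n)`).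
* **`combPos_sahiE_of_uncovered`** — UNCOVERED REDUCTION AT THE COMB LEVEL (any events of any finite cube, no monotonicity): if every uncovered slot map
  (no slot's event contains the intersection of the others, `SahiMixture.Uncovered`) has `E_m` comb-positive at multidegree `m`, then every slot map does
  (strong induction; a covered slot is the total-meet rung `combPos_sahiE_ind_of_totalMeet_local` = P5's defect expansion with vanishing top defect; orders `≤ 2`
  by hand).  **`combHereditary_of_irredundant`** — hence `CombHereditary` is decided by the IRREDUNDANT slot maps (`m ≤ n`).
* **`combHereditary_three_of_cubic`** — THREE INCREASING EVENTS: comb positivity of the single cubic row `E_3(1_{U_0},1_{U_1},1_{U_2})` already makes the whole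
  seven-member ∩-closed family comb-positive at every order (irredundant triples in `[3]` are the singletons; pairs are (M⁺-2)).  Extends range lifting
  (`SahiCombRange.combPos_sahiE_ind_iff_of_three`: all MULTISETS of the three events) to all multisets of their INTERSECTIONS.
* **`combHereditary_orCoord_three`** — COMB H-MIX(3): for increasing `U_0,U_1,U_2` ignoring `e` with the cubic row comb-positive, OR-ing the coordinate event
  `{e ∈ ω}` into any sub-collection gives a `CombHereditary` family (gen 4's disjunctive closure + the previous item); `@[conjecture] CombHereditaryMixture`
  (comb H-MIX, every `n`; a sub-statement of (M⁺-k) ∀k since all members are increasing) with **`combHereditary_orFamily_of_mixture`**: comb H-MIX ⇒ every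
  HITTING FAMILY (the ∩-closed family of finitely many OR-events `{ω ∩ S_i ≠ ∅}`) on every finite cube is comb-positive at every order; `combHereditaryMixture_three`.
* **`combHereditary_orFamily_three`**, `sahiE_hitting_three_nonneg` — UNCONDITIONALLY: for any three coordinate sets `S_0,S_1,S_2` of any finite cube, every
  multiset drawn from the seven hitting events `{ω | ω ∩ S_i ≠ ∅ ∀ i ∈ K}` has `E_m(μ_p)` comb-positive at multidegree `m`, in particular `≥ 0` for every
  product measure.
HONEST FRAMING: nothing here asserts (M⁺-k) or `C_k` for `k ≥ 3` in general; comb H-MIX is typed as a conjecture and proved for three events only. [this work]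
-/

noncomputable section

open scoped Classical

namespace Summit.CriticalPhenomena.PercolationContinuityZ3.Theorems

open Finset Function
open Literature.Combinatorics.Sahi2008
open Literature.Probability.Percolation.DecisionTree (ind ind_of_mem ind_of_not_mem ind_nonneg)
open SahiComb
open SahiMixture (Uncovered Irredundant)
open SahiCombDisjunct (orCoord CombAllOrders)

variable {ι : Type} [Fintype ι]

namespace SahiCombHereditary

/-! ### The hereditary comb class -/

/-- **The hereditary comb class**: the intersection-closed family `(⋂_{i∈K} A_i)_{K ⊆ [n]}` generated by the events `A` of the finite cube `2^ι` is
comb-positive at EVERY order — for every `m` and every slot map `K : Fin m → Finset (Fin n)`, `p ↦ E_m(μ_p; 1_{A_{K_0}},…,1_{A_{K_{m−1}}})` is a nonnegative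
combination of the degree-`m` tensor-Bernstein basis. (Comb-level mirror of `SahiMixture.HereditaryAllOrders`.) [this work] -/
def CombHereditary {n : ℕ} (A : Fin n → Set (Set ι)) : Prop :=
  ∀ (m : ℕ) (K : Fin m → Finset (Fin n)),
    CombPos (fun _ : ι => m) (fun p => sahiE (bernoulliWeight p) m (fun j => ind (⋂ i ∈ K j, A i)))

/-- `CombHereditary` contains comb positivity of every multiset of the events themselves (`CombAllOrders`). [this work] -/
theorem CombHereditary.combAllOrders {n : ℕ} {A : Fin n → Set (Set ι)} (h : CombHereditary A) : CombAllOrders A := by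
  intro m s
  have e : (fun j => ind (A (s j))) = fun j => ind (⋂ i ∈ ({s j} : Finset (Fin n)), A i) := by
    funext j; rw [Finset.set_biInter_singleton]
  rw [show (fun p => sahiE (bernoulliWeight p) m (fun j => ind (A (s j))))
      = fun p => sahiE (bernoulliWeight p) m (fun j => ind (⋂ i ∈ ({s j} : Finset (Fin n)), A i)) from by rw [e]]
  exact h m (fun j => {s j})

/-- The law-level shadow: a `CombHereditary` family is hereditarily all-orders positive under every product measure. [this work] -/
theorem CombHereditary.hereditaryAllOrders {n : ℕ} {A : Fin n → Set (Set ι)} (h : CombHereditary A) (p : ι → unitInterval) :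
    SahiMixture.HereditaryAllOrders (bernoulliWeight p) A :=
  fun m K => (h m K).nonneg p

/-! ### Uncovered reduction at the comb level -/

/-- Order two with a covered slot: if `B_1 ⊆ B_0` then `E_2(1_{B_0},1_{B_1}) = μ(B_1)(1 − μ(B_0))`. [folklore] -/
theorem sahiE_two_of_subset (μ : Set ι → ℝ) {B₀ B₁ : Set (Set ι)} (h : B₁ ⊆ B₀) :
    sahiE μ 2 ![ind B₀, ind B₁] = ex μ (ind B₁) * (1 - ex μ (ind B₀)) := by
  rw [sahiE_two_apply]
  have e : (![ind B₀, ind B₁] : Fin 2 → Set ι → ℝ) 0 * (![ind B₀, ind B₁] : Fin 2 → Set ι → ℝ) 1 = ind B₁ := by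
    funext ω
    simp only [Matrix.cons_val_zero, Matrix.cons_val_one, Pi.mul_apply]
    by_cases hω : ω ∈ B₁
    · rw [ind_of_mem hω, ind_of_mem (h hω), one_mul]
    · rw [ind_of_not_mem hω, mul_zero]
  rw [e]
  simp only [Matrix.cons_val_zero, Matrix.cons_val_one]
  ring

/-- **UNCOVERED REDUCTION AT THE COMB LEVEL.**  Let `B : κ → Set (Set ι)` be any events of a finite cube.  If for every UNCOVERED slot map `s` (no slot's event
contains the intersection of the other slots' events) the functional `p ↦ E_m(μ_p; 1_{B_{s 0}},…)` is comb-positive at multidegree `m`, then it is for EVERY slot map.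
Strong induction on `m`: at a covered slot the top defect of P5's defect expansion vanishes and every remaining term is a product of the `μ_p`-expectation of a
nonnegative function (comb-positive at multidegree `1`) with the functional of a proper sub-multiset (`combPos_sahiE_ind_of_totalMeet_local`); orders `≤ 2` directly.
No monotonicity is needed. [this work] -/
theorem combPos_sahiE_of_uncovered {κ : Type*} (B : κ → Set (Set ι))
    (hunc : ∀ (m : ℕ) (s : Fin m → κ), Uncovered B s →
      CombPos (fun _ : ι => m) (fun p => sahiE (bernoulliWeight p) m (fun j => ind (B (s j))))) :
    ∀ (m : ℕ) (s : Fin m → κ), CombPos (fun _ : ι => m) (fun p => sahiE (bernoulliWeight p) m (fun j => ind (B (s j)))) := by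
  intro m
  induction m using Nat.strong_induction_on with
  | _ m ih =>
    intro s
    by_cases hs : Uncovered B s
    · exact hunc m s hs
    obtain ⟨a, ha⟩ : ∃ a, (⋂ b ∈ (univ : Finset (Fin m)).erase a, B (s b)) ⊆ B (s a) := by
      simpa [Uncovered] using hs
    rcases m with _ | _ | _ | k
    · exact a.elim0
    · exact (combPos_ex_ind (B (s 0))).congr fun _ => sahiE_one_apply _ _
    · -- order two: the other slot's event is contained in `B (s a)`
      have hcov : ∀ b : Fin 2, b ≠ a → B (s b) ⊆ B (s a) := fun b hb ω hω =>
        ha (Set.mem_iInter₂.2 fun c hc => by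
          have hca : c ≠ a := Finset.ne_of_mem_erase hc
          have hcb : c = b := by omega
          rw [hcb]; exact hω)
      have hdeg : (fun _ : ι => (1 : ℕ)) + (fun _ : ι => (1 : ℕ)) ≤ fun _ : ι => 2 := fun _ => by simp
      fin_cases a
      · have h10 : B (s 1) ⊆ B (s 0) := hcov 1 (by decide)
        refine ((combPos_ex_ind (B (s 1))).mul_of_le (combPos_one_sub_ex_ind (B (s 0))) hdeg).congr fun p => ?_
        have e : (fun j => ind (B (s j))) = (![ind (B (s 0)), ind (B (s 1))] : Fin 2 → Set ι → ℝ) := by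
          funext j; fin_cases j <;> rfl
        rw [e, sahiE_two_of_subset _ h10]
      · have h01 : B (s 0) ⊆ B (s 1) := hcov 0 (by decide)
        refine ((combPos_ex_ind (B (s 0))).mul_of_le (combPos_one_sub_ex_ind (B (s 1))) hdeg).congr fun p => ?_
        have e : (fun j => ind (B (s j))) = (fun j => (![ind (B (s 1)), ind (B (s 0))] : Fin 2 → Set ι → ℝ) (Equiv.swap 0 1 j)) := by
          funext j; fin_cases j <;> rfl
        rw [e, sahiE_comp_perm (bernoulliWeight p) 2 (Equiv.swap 0 1) ![ind (B (s 1)), ind (B (s 0))], sahiE_two_of_subset _ h01]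
    · -- order `k + 3`: the covered slot is a total meet
      refine combPos_sahiE_ind_of_totalMeet_local (fun j => B (s j)) a ?_ fun j e hj => ih j (by omega) (fun l => s (e l))
      refine Set.Subset.trans (fun ω hω => Set.mem_iInter₂.2 fun b hb => ?_) ha
      obtain ⟨j, rfl⟩ := Fin.exists_succAbove_eq (Finset.ne_of_mem_erase hb)
      exact Set.mem_iInter.1 hω j

/-- **`CombHereditary` is decided by the irredundant slot maps (at most `n` slots, each index set keeping a private element).** [this work] -/
theorem combHereditary_of_irredundant {n : ℕ} (A : Fin n → Set (Set ι))
    (hirr : ∀ (m : ℕ) (K : Fin m → Finset (Fin n)), Irredundant K →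
      CombPos (fun _ : ι => m) (fun p => sahiE (bernoulliWeight p) m (fun j => ind (⋂ i ∈ K j, A i)))) :
    CombHereditary A :=
  fun m K => combPos_sahiE_of_uncovered (fun L : Finset (Fin n) => ⋂ i ∈ L, A i)
    (fun m' K' hK' => hirr m' K' (Irredundant.of_uncovered A K' hK')) m K

/-! ### Irredundant families with `n` members are the singletons -/

/-- An irredundant family of `n` subsets of `Fin n` consists of the singletons along a permutation. [this work] -/
theorem exists_perm_of_irredundant {n : ℕ} {K : Fin n → Finset (Fin n)} (hK : Irredundant K) :
    ∃ σ : Equiv.Perm (Fin n), ∀ j, K j = {σ j} := by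
  have hex : ∀ a : Fin n, ∃ i : Fin n, i ∈ K a ∧ i ∉ ((univ : Finset (Fin n)).erase a).biUnion K := fun a => by
    simpa [Finset.subset_iff] using hK a
  choose f hf using hex
  have hpriv : ∀ a b, b ≠ a → f a ∉ K b := fun a b hba hfb =>
    (hf a).2 (Finset.mem_biUnion.2 ⟨b, Finset.mem_erase.2 ⟨hba, Finset.mem_univ b⟩, hfb⟩)
  have hinj : Injective f := by
    intro a b hab
    by_contra hne
    exact hpriv a b (Ne.symm hne) (hab ▸ (hf b).1)
  have hbij : Bijective f := (Fintype.bijective_iff_injective_and_card f).2 ⟨hinj, rfl⟩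
  refine ⟨Equiv.ofBijective f hbij, fun j => ?_⟩
  ext i
  simp only [Equiv.ofBijective_apply, Finset.mem_singleton]
  constructor
  · intro hi
    obtain ⟨b, rfl⟩ := hbij.2 i
    by_contra hb
    exact hpriv b j (fun hjb => hb (congrArg f hjb.symm)) hi
  · rintro rfl
    exact (hf j).1

/-! ### Three increasing events: the cubic row carries the whole intersection-closed family -/

omit [Fintype ι] in
/-- Intersections of increasing events are increasing. [folklore] -/
theorem isUpperSet_biInter {n : ℕ} {U : Fin n → Set (Set ι)} (hU : ∀ j, IsUpperSet (U j)) (L : Finset (Fin n)) :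
    IsUpperSet (⋂ i ∈ L, U i) :=
  isUpperSet_iInter₂ fun i _ => hU i

/-- Rows of order `≤ 2` of the ∩-closed family of increasing events are comb-positive ((M⁺-0,1,2)). [this work] -/
theorem combPos_sahiE_biInter_of_le_two {n m : ℕ} (hm : m ≤ 2) {U : Fin n → Set (Set ι)} (hU : ∀ j, IsUpperSet (U j))
    (K : Fin m → Finset (Fin n)) :
    CombPos (fun _ : ι => m) (fun p => sahiE (bernoulliWeight p) m (fun j => ind (⋂ i ∈ K j, U i))) :=
  masterFamilyCombPos_of_le_two hm ι (fun j => ⋂ i ∈ K j, U i) fun j => isUpperSet_biInter hU (K j)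

/-- **THREE INCREASING EVENTS: the single cubic row carries the whole ∩-closed family.**  If `U_0, U_1, U_2` are increasing and
`E_3(μ_p; 1_{U_0},1_{U_1},1_{U_2})` is comb-positive at multidegree `3`, then EVERY multiset drawn from the seven intersections `⋂_{i∈K} U_i` has `E_m(μ_p)`
comb-positive at multidegree `m`.  (Irredundant reduction: the only irredundant triple of index sets in `[3]` is the family of singletons; pairs are (M⁺-2).)
[this work] -/
theorem combHereditary_three_of_cubic (U : Fin 3 → Set (Set ι)) (hU : ∀ j, IsUpperSet (U j))
    (h3 : CombPos (fun _ : ι => 3) (fun p => sahiE (bernoulliWeight p) 3 (fun j => ind (U j)))) :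
    CombHereditary U := by
  refine combHereditary_of_irredundant U fun m K hK => ?_
  have hm : m ≤ 3 := hK.card_le
  rcases Nat.lt_or_ge m 3 with hlt | hge
  · exact combPos_sahiE_biInter_of_le_two (by omega) hU K
  · obtain rfl : m = 3 := le_antisymm hm hge
    obtain ⟨σ, hσ⟩ := exists_perm_of_irredundant hK
    have e : (fun j => ind (⋂ i ∈ K j, U i)) = fun j => (fun i => ind (U i)) (σ j) := by
      funext j; rw [hσ j, Finset.set_biInter_singleton]
    refine h3.congr fun p => ?_
    rw [e, sahiE_comp_perm (bernoulliWeight p) 3 σ (fun i => ind (U i))]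

/-- Conversely `CombHereditary` contains the cubic row; so over three increasing events `CombHereditary U ↔` the cubic row is comb-positive. [this work] -/
theorem combHereditary_three_iff (U : Fin 3 → Set (Set ι)) (hU : ∀ j, IsUpperSet (U j)) :
    CombHereditary U ↔ CombPos (fun _ : ι => 3) (fun p => sahiE (bernoulliWeight p) 3 (fun j => ind (U j))) :=
  ⟨fun h => h.combAllOrders 3 id, combHereditary_three_of_cubic U hU⟩

/-! ### Comb H-MIX: typed for every `n`, proved for three events -/

/-- **COMB H-MIX(3).**  For increasing `U_0,U_1,U_2` ignoring the coordinate `e` whose cubic row is comb-positive, and any `G`: the family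
`(U_j ∪ [G j]·{e ∈ ω})_j` is `CombHereditary` — its whole ∩-closed family (members `U_K ∪ ({e ∈ ω} ∩ U_{K∖G})`) is comb-positive at every order.
(Gen 4's order-3 disjunctive closure supplies the new cubic row; `combHereditary_three_of_cubic` does the rest.) [this work] -/
theorem combHereditary_orCoord_three (U : Fin 3 → Set (Set ι)) (e : ι) (G : Fin 3 → Bool) (hU : ∀ j, IsUpperSet (U j))
    (hUe : ∀ (j : Fin 3) (b : Bool), secAt e b (U j) = U j)
    (h3 : CombPos (fun _ : ι => 3) (fun p => sahiE (bernoulliWeight p) 3 (fun j => ind (U j)))) :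
    CombHereditary (orCoord U e G) := by
  refine combHereditary_three_of_cubic _ (SahiCombDisjunct.isUpperSet_orCoord hU e G) ?_
  refine (SahiCombDisjunct.combPos_sahiE_three_unionCoord U hU e hUe h3 (fun j => G j = true)).congr fun p => ?_
  congr 1; funext j
  unfold SahiCombDisjunct.orCoord
  cases G j <;> simp

/-- **COMB H-MIX (typed conjecture, every `n`)** (this seat, gen 8; HIERARCHY.md §15): for every finite cube, every family `U` of increasing events ignoring a
coordinate `e` that is `CombHereditary`, and every `G`, the OR-ed family `(U_j ∪ [G j]·{e ∈ ω})_j` is `CombHereditary`.  A SUB-STATEMENT of (M⁺-k) ∀k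
(`MasterFamilyCombPos`: every family of increasing events is comb-positive), and the comb-level form of the law-level H-MIX, which is TRUE at `n = 4`
(`SahiMixture.hereditaryMixture_four`) and FALSE at `n = 6` (`SahiMixture.not_hereditaryMixturePositivity`; that violator is not a product-measure pattern law).
THEOREM for `n = 3` (`combHereditaryMixture_three`).  OPEN in general; an obligation of our theories, never a fact: use as `(h : CombHereditaryMixture)`.
[status: open] -/
@[conjecture] def CombHereditaryMixture : Prop :=
  ∀ (ι : Type) [Fintype ι] (n : ℕ) (U : Fin n → Set (Set ι)) (e : ι) (G : Fin n → Bool),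
    (∀ j, IsUpperSet (U j)) → (∀ (j : Fin n) (b : Bool), secAt e b (U j) = U j) → CombHereditary U →
      CombHereditary (orCoord U e G)

/-- **Comb H-MIX holds for three events** (indeed from the cubic row of `U` alone). [this work] -/
theorem combHereditaryMixture_three (U : Fin 3 → Set (Set ι)) (e : ι) (G : Fin 3 → Bool) (hU : ∀ j, IsUpperSet (U j))
    (hUe : ∀ (j : Fin 3) (b : Bool), secAt e b (U j) = U j) (hher : CombHereditary U) :
    CombHereditary (orCoord U e G) :=
  combHereditary_orCoord_three U e G hU hUe (hher.combAllOrders 3 id)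

/-! ### Hitting families -/

/-- The empty family (every member `∅`) is `CombHereditary`: an irredundant slot map has nonempty index sets, so every slot is `∅` and `E_m ≡ 0`. [this work] -/
theorem combHereditary_empty (n : ℕ) : CombHereditary (fun _ : Fin n => (∅ : Set (Set ι))) := by
  refine combHereditary_of_irredundant _ fun m K hK => ?_
  have hne : ∀ j, (K j).Nonempty := fun j => by
    by_contra h
    rw [Finset.not_nonempty_iff_eq_empty] at h
    exact hK j (by rw [h]; exact Finset.empty_subset _)
  have e : (fun j => ind (⋂ i ∈ K j, (fun _ : Fin n => (∅ : Set (Set ι))) i)) = fun _ : Fin m => ind (∅ : Set (Set ι)) := by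
    funext j
    obtain ⟨i, hi⟩ := hne j
    have h0 : (⋂ i ∈ K j, (fun _ : Fin n => (∅ : Set (Set ι))) i) = ∅ :=
      Set.eq_empty_of_subset_empty fun ω hω => by simpa using Set.mem_iInter₂.1 hω i hi
    rw [h0]
  rw [show (fun p => sahiE (bernoulliWeight p) m (fun j => ind (⋂ i ∈ K j, (fun _ : Fin n => (∅ : Set (Set ι))) i)))
      = fun p => sahiE (bernoulliWeight p) m (fun _ : Fin m => ind (∅ : Set (Set ι))) from by rw [e]]
  exact (CombPos.zero _).congr fun p => SahiCombDisjunct.sahiE_ind_empty_eq_zero (bernoulliWeight p) m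

/-- **THE REDUCTION.**  Comb H-MIX implies: for every finite cube and every finite family of OR-events `{ω | ω ∩ S_i ≠ ∅}` (arbitrary coordinate sets), the
HITTING FAMILY they generate (`{ω | ω ∩ S_i ≠ ∅ ∀ i ∈ K}`, all `K`) is comb-positive at EVERY order — conjecture OR(∞) of HIERARCHY §11 together with all
intersections.  Induction on the activated coordinates from the empty family, one mixing step per coordinate, the ∩-closed family carried along. [this work] -/
theorem combHereditary_orFamily_of_mixture (hmix : CombHereditaryMixture) (n : ℕ) (S : Fin n → Finset ι) :
    CombHereditary (fun i => {ω : Set ι | ∃ a ∈ S i, a ∈ ω}) := by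
  classical
  suffices key : ∀ T : Finset ι, CombHereditary (fun i => {ω : Set ι | ∃ a ∈ S i ∩ T, a ∈ ω}) by
    have h := key Finset.univ
    simp only [Finset.inter_univ] at h
    exact h
  intro T
  induction T using Finset.induction_on with
  | empty =>
    have e : (fun i : Fin n => {ω : Set ι | ∃ a ∈ S i ∩ (∅ : Finset ι), a ∈ ω}) = fun _ => (∅ : Set (Set ι)) := by
      funext i; ext ω; simp
    rw [e]
    exact combHereditary_empty n
  | insert e T heT ih =>
    set W : Fin n → Set (Set ι) := fun i => {ω : Set ι | ∃ a ∈ S i ∩ T, a ∈ ω} with hW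
    have hWup : ∀ i, IsUpperSet (W i) := fun i => SahiCombDisjunct.isUpperSet_orEvent _
    have hWe : ∀ (i : Fin n) (b : Bool), secAt e b (W i) = W i := fun i b =>
      SahiCombDisjunct.secAt_orEvent_of_notMem e (S i ∩ T) (fun h => heT (Finset.mem_inter.1 h).2) b
    have hcl' := hmix ι n W e (fun i => decide (e ∈ S i)) hWup hWe ih
    have e' : orCoord W e (fun i => decide (e ∈ S i)) = fun i => {ω : Set ι | ∃ a ∈ S i ∩ insert e T, a ∈ ω} := by
      funext i
      unfold SahiCombDisjunct.orCoord
      ext ω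
      by_cases hie : e ∈ S i
      · simp only [hie, decide_true, cond_true, hW, Set.mem_union, Set.mem_setOf_eq, Finset.mem_inter, Finset.mem_insert]
        constructor
        · rintro (⟨a, ⟨haS, haT⟩, haω⟩ | hω)
          · exact ⟨a, ⟨haS, Or.inr haT⟩, haω⟩
          · exact ⟨e, ⟨hie, Or.inl rfl⟩, hω⟩
        · rintro ⟨a, ⟨haS, rfl | haT⟩, haω⟩
          · exact Or.inr haω
          · exact Or.inl ⟨a, ⟨haS, haT⟩, haω⟩
      · simp only [hie, decide_false, cond_false, hW, Set.mem_setOf_eq, Finset.mem_inter, Finset.mem_insert]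
        constructor
        · rintro ⟨a, ⟨haS, haT⟩, haω⟩
          exact ⟨a, ⟨haS, Or.inr haT⟩, haω⟩
        · rintro ⟨a, ⟨haS, rfl | haT⟩, haω⟩
          · exact absurd haS hie
          · exact ⟨a, ⟨haS, haT⟩, haω⟩
    rw [e'] at hcl'
    exact hcl'

/-- **UNCONDITIONALLY: the hitting family of any THREE coordinate sets is comb-positive at every order.**  For `S_0,S_1,S_2 ⊆ ι` and every slot map
`K : Fin m → Finset (Fin 3)`, `p ↦ E_m(μ_p; (1_{{ω | ω ∩ S_i ≠ ∅ ∀ i ∈ K_j}})_j)` is a nonnegative combination of the degree-`m` tensor-Bernstein basis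
(three OR-events are comb-positive at order 3 — `…SahiCombVennThree` / gen 4 — and `combHereditary_three_of_cubic`). [this work] -/
theorem combHereditary_orFamily_three (S : Fin 3 → Finset ι) : CombHereditary (fun i => {ω : Set ι | ∃ a ∈ S i, a ∈ ω}) :=
  combHereditary_three_of_cubic _ (fun i => SahiCombDisjunct.isUpperSet_orEvent (S i))
    (SahiCombDisjunct.combAllOrders_orFamily_three S 3 id)

/-- Law-level shadow: under every product measure, every multiset drawn from the hitting family of three coordinate sets has `E_m ≥ 0`. [this work] -/
theorem sahiE_hitting_three_nonneg (S : Fin 3 → Finset ι) (p : ι → unitInterval) (m : ℕ) (K : Fin m → Finset (Fin 3)) :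
    0 ≤ sahiE (bernoulliWeight p) m (fun j => ind (⋂ i ∈ K j, {ω : Set ι | ∃ a ∈ S i, a ∈ ω})) :=
  (combHereditary_orFamily_three S m K).nonneg p

end SahiCombHereditary

end Summit.CriticalPhenomena.PercolationContinuityZ3.Theorems

end
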